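import Summits.CriticalPhenomena.PercolationContinuityZ3.Theorems.Transplant.SkelFrmBParamsSlotsT
import Summits.CriticalPhenomena.PercolationContinuityZ3.Theorems.Transplant.SkelNegBParamsSlotsT
import Summits.CriticalPhenomena.PercolationContinuityZ3.Theorems.Transplant.SkelFrmBParamsFineSizeA
import Summits.CriticalPhenomena.PercolationContinuityZ3.Theorems.Transplant.SkelNegBParamsFineSizeA
import Summits.CriticalPhenomena.PercolationContinuityZ3.Theorems.Transplant.SkelFrm1SlotTypes
import Summits.CriticalPhenomena.PercolationContinuityZ3.Theorems.Transplant.SkelFrm1ParamsPO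
import Summits.CriticalPhenomena.PercolationContinuityZ3.Theorems.Transplant.SkelFrm1ParamsLBL
import Summits.CriticalPhenomena.PercolationContinuityZ3.Theorems.Transplant.SkelFrmBParamsKitA
import Summits.CriticalPhenomena.PercolationContinuityZ3.Theorems.Transplant.SkelFrmBParamsKitS
import Summits.CriticalPhenomena.PercolationContinuityZ3.Theorems.Transplant.SkelFrm1ParamsLF
import Summits.CriticalPhenomena.PercolationContinuityZ3.Theorems.Transplant.SkelFrm1ParamsLO
import Summits.CriticalPhenomena.PercolationContinuityZ3.Theorems.Transplant.SkelFrmBParamsLF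
import Summits.CriticalPhenomena.PercolationContinuityZ3.Theorems.Transplant.SkelFrmBParamsFineSize
import Summits.CriticalPhenomena.PercolationContinuityZ3.Theorems.Transplant.SkelFrmBParamsLFA
import Summits.CriticalPhenomena.PercolationContinuityZ3.Theorems.Transplant.SkelFrmBParamsLO
import Summits.CriticalPhenomena.PercolationContinuityZ3.Theorems.Transplant.SkelFrmBParamsB
import Summits.CriticalPhenomena.PercolationContinuityZ3.Theorems.Transplant.SkelFrmBParamsSlotsR
import Summits.CriticalPhenomena.PercolationContinuityZ3.Theorems.Transplant.SkelFrmBParamsSlotsRS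
import Summits.CriticalPhenomena.PercolationContinuityZ3.Theorems.Transplant.SkelFrmBParamsSlots
import Summits.CriticalPhenomena.PercolationContinuityZ3.Theorems.Transplant.SkelFrmBParamsSched
import Summits.CriticalPhenomena.PercolationContinuityZ3.Theorems.Transplant.SkelFrmBParamsReachFC
import Summits.CriticalPhenomena.PercolationContinuityZ3.Theorems.Transplant.SkelNegBParamsSlotsTA
import Summits.CriticalPhenomena.PercolationContinuityZ3.Theorems.Transplant.PlanarSkeletonFrmDefs
import Summits.CriticalPhenomena.PercolationContinuityZ3.Theorems.Transplant.SkelPhiStepIDataNS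
import HarnessLib

/-!
# N2 (frames-only node `SamePDropOfSkeletonFrm₁`, OPEN) params column over `PlanarSkeletonFrm` — (ζ″) ledger, shape (B′) of record ((R-14)):
# MECHANICAL PORT of N1's `SkelNegBParamsSlotsTA` — chain of record `NegB`, part SlotsT-A — the (ζ′) twin of part SlotsT §3 / part Slots §3 at `A := Aof κ = 20·K`: THE (ζ′)
# CELLS UNDER A BOX FLOOR and AT THE BOX VALUE OF RECORD `g := KS.gT mk gx` — **`sA_ge_of_floor`** (`4K(r+2) ≤ M_L ⊢ Kq·(6r+11) ≤ s₀ ∧ Kq·(14r+27) ≤ s₁`, from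
# `true_size₀A/₁A`), … (N1 title abridged; see `SkelNegBParamsSlotsTA`)
builds on p205010 (kernel theorem, internal audit signed; external expert review pending) — nothing in this file uses p205010; NOTHING is claimed about the
open node `SamePDropOfSkeletonFrm₁` (`SamePDropOfSkeletonNeg₁` is CLOSED in the tree and untouched by this file).
Status sentence (coordinator 2026-08-20T04:30Z): "θ(p_c) = 0 on ℤ^d, all d ≥ 2 — kernel-verified (Lean 4/Mathlib, standard axioms); internal adversarial
audit SIGNED 2026-08-20 04:29Z; external expert review pending."
Lane `prim-bschramm-*`, seat `prim-bschramm-stmt` (gen 19); helper file (`--supports stmt-CriticalPhenomena-4575 --as helper`); ledger HOME/prim-bschramm-stmt/FRM-PARAMS.md §9, (R-14).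
PORT RULES (HOME/prim-bschramm-stmt-g19/lean/port_frm.py, the tool of record per (R-14)): outer namespace `PlanarSkeletonNeg ↦ PlanarSkeletonFrm`, carrier binder
`(Φ : PlanarSkeletonFrm G)`, record binder `(D : Skelφ.StepI.DataNS V)` (the selectors travel IN the record, `SkelPhiStepIDataNS`); section variables INLINED into every
declaration header; inner namespaces (`Neg`/`NegB`/`KS`/…) and every short name KEPT so all cross-references resolve unchanged; declarations using no section variable are
NOT re-declared (N1's originals are referenced fully qualified). Mathematical content, proofs, docstrings and citations are N1's, verbatim, except where stated next.
SELECTORS IN THIS FILE ((R-14) condition of record — joint selection, `D.sN`'s first argument is the literal handed to `D.sM`): none (pure port; the pairs are read through their N1 names).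
N1 HEADER (kept for the reader):
helper file (`--supports stmt-CriticalPhenomena-4575 --as helper`); ledger HOME/prim-bschramm-stmt/NEG-PARAMS.md.
* **`sA_ge_of_floor`**, `sA_ge_of_floor'`, **`cells_geTA`**, `cells_geTA'`, **`r_geTA`**.
[cite: KozmaNitzan2024, §4 Theorem 6 (pp. 25–31): the order of constants; pp. 25–26 (two-unit cells)] [cite: MartineauTassion2017, §3.2 Lemma 3.5]
-/

noncomputable section

open scoped Classical

namespace Summit.CriticalPhenomena.PercolationContinuityZ3.Theorems.Transplant

namespace PlanarSkeletonFrm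

namespace NegB

namespace KS

open Literature.Probability.Percolation Literature.Probability.LatticeModels SimpleGraph
open SkelConc (Consts)
open Skelφ.StepI (DataN)
open Neg

/-! ## §1 The (ζ′) cells under a box floor -/

section Cells

/-- **TRUE (ζ′) CELL SIZES UNDER A BOX FLOOR**: for ANY `r` with `4K(r+2) ≤ M_L`, `Kq·(6r + 11) ≤ s₀` and `Kq·(14r + 27) ≤ s₁` (from `true_size₀A/₁A`:
`M_L + 1 ≤ 23·(s₀+2)`, `≤ 11·(s₁+2)`, and `K = 40·Kq`). [folklore] -/
theorem sA_ge_of_floor (κ : Consts) {V : Type} [DecidableEq V] [Countable V] {G : SimpleGraph V} [G.LocallyFinite] (Φ : PlanarSkeletonFrm G) (t : V) (p : unitInterval) (D : Skelφ.StepI.DataNS V) (g : ℕ) (f : ℕ) (hN : EqNumL κ Φ t p D g f) (hκ : (hL κ Φ t p D g f).natAbs ≤ 10 * nL κ Φ t p D g f) {r : ℕ} (hr : 4 * Neg.K κ * (r + 2) ≤ ML κ Φ t p D g) :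
    (Neg.Kq κ : ℤ) * (6 * (r : ℤ) + 11) ≤ (((fcellsA κ Φ t p D g f).s 0 : ℕ) : ℤ) ∧ (Neg.Kq κ : ℤ) * (14 * (r : ℤ) + 27) ≤ (((fcellsA κ Φ t p D g f).s 1 : ℕ) : ℤ) := by
  have h0 := true_size₀A κ Φ t p D g f hN hκ
  have h1 := true_size₁A κ Φ t p D g f hN hκ
  have hr' : 4 * (Neg.K κ : ℤ) * ((r : ℤ) + 2) ≤ (ML κ Φ t p D g : ℤ) := by exact_mod_cast hr
  have hKq : (1 : ℤ) ≤ Neg.Kq κ := by exact_mod_cast Neg.one_le_Kq κ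
  have hKe : (Neg.K κ : ℤ) = 40 * Neg.Kq κ := by rw [Neg.K_eq]; push_cast; ring
  have hr0 : (0 : ℤ) ≤ r := by positivity
  rw [hKe] at hr'
  constructor <;> nlinarith

/-- Today's shapes (`Kq ≥ 1`): `6r + 11 ≤ s₀` and `14r + 27 ≤ s₁` under `4K(r+2) ≤ M_L`. [folklore] -/
theorem sA_ge_of_floor' (κ : Consts) {V : Type} [DecidableEq V] [Countable V] {G : SimpleGraph V} [G.LocallyFinite] (Φ : PlanarSkeletonFrm G) (t : V) (p : unitInterval) (D : Skelφ.StepI.DataNS V) (g : ℕ) (f : ℕ) (hN : EqNumL κ Φ t p D g f) (hκ : (hL κ Φ t p D g f).natAbs ≤ 10 * nL κ Φ t p D g f) {r : ℕ} (hr : 4 * Neg.K κ * (r + 2) ≤ ML κ Φ t p D g) :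
    6 * (r : ℤ) + 11 ≤ (((fcellsA κ Φ t p D g f).s 0 : ℕ) : ℤ) ∧ 14 * (r : ℤ) + 27 ≤ (((fcellsA κ Φ t p D g f).s 1 : ℕ) : ℤ) := by
  obtain ⟨h0, h1⟩ := sA_ge_of_floor κ Φ t p D g f hN hκ hr
  have hKq : (1 : ℤ) ≤ Neg.Kq κ := by exact_mod_cast Neg.one_le_Kq κ
  have hr0 : (0 : ℤ) ≤ r := by positivity
  constructor <;> nlinarith

end Cells

/-! ## §2 The (ζ′) cells at the box value of record -/

section AtValues

/-- **THE (ζ′) CELLS AT `g := gT`**: `Kq·(6·RA' + 11) ≤ s₀`, `Kq·(14·RA' + 27) ≤ s₁` (any width `f`). [folklore] -/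
theorem cells_geTA (κ : Consts) {V : Type} [DecidableEq V] [Countable V] {G : SimpleGraph V} [G.LocallyFinite] (Φ : PlanarSkeletonFrm G) (t : V) (p : unitInterval) (D : Skelφ.StepI.DataNS V) (mk : ℕ) (gx : Neg.FSlot) (f : ℕ) (hN : EqNumL κ Φ t p D (gT mk gx κ Φ t p D) f) (hκ : (hL κ Φ t p D (gT mk gx κ Φ t p D) f).natAbs ≤ 10 * nL κ Φ t p D (gT mk gx κ Φ t p D) f) :
    (Neg.Kq κ : ℤ) * (6 * (RA' κ Φ t p D mk : ℤ) + 11) ≤ (((fcellsA κ Φ t p D (gT mk gx κ Φ t p D) f).s 0 : ℕ) : ℤ) ∧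
      (Neg.Kq κ : ℤ) * (14 * (RA' κ Φ t p D mk : ℤ) + 27) ≤ (((fcellsA κ Φ t p D (gT mk gx κ Φ t p D) f).s 1 : ℕ) : ℤ) :=
  sA_ge_of_floor κ Φ t p D _ f hN hκ (ML_floorsT κ Φ t p D mk gx).1

/-- Today's shapes at `g := gT` for the (ζ′) cells: `6·RA' + 11 ≤ s₀`, `14·RA' + 27 ≤ s₁`. [folklore] -/
theorem cells_geTA' (κ : Consts) {V : Type} [DecidableEq V] [Countable V] {G : SimpleGraph V} [G.LocallyFinite] (Φ : PlanarSkeletonFrm G) (t : V) (p : unitInterval) (D : Skelφ.StepI.DataNS V) (mk : ℕ) (gx : Neg.FSlot) (f : ℕ) (hN : EqNumL κ Φ t p D (gT mk gx κ Φ t p D) f) (hκ : (hL κ Φ t p D (gT mk gx κ Φ t p D) f).natAbs ≤ 10 * nL κ Φ t p D (gT mk gx κ Φ t p D) f) :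
    6 * (RA' κ Φ t p D mk : ℤ) + 11 ≤ (((fcellsA κ Φ t p D (gT mk gx κ Φ t p D) f).s 0 : ℕ) : ℤ) ∧
      14 * (RA' κ Φ t p D mk : ℤ) + 27 ≤ (((fcellsA κ Φ t p D (gT mk gx κ Φ t p D) f).s 1 : ℕ) : ℤ) :=
  sA_ge_of_floor' κ Φ t p D _ f hN hκ (ML_floorsT κ Φ t p D mk gx).1

/-- **The (ζ′) fine radii at `g := gT`**: `K·Kq·(6RA'+11) ≤ r₀`, `K·Kq·(14RA'+27) ≤ r₁` (`r_i = K·s_i`). [folklore] -/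
theorem r_geTA (κ : Consts) {V : Type} [DecidableEq V] [Countable V] {G : SimpleGraph V} [G.LocallyFinite] (Φ : PlanarSkeletonFrm G) (t : V) (p : unitInterval) (D : Skelφ.StepI.DataNS V) (mk : ℕ) (gx : Neg.FSlot) (f : ℕ) (hN : EqNumL κ Φ t p D (gT mk gx κ Φ t p D) f) (hκ : (hL κ Φ t p D (gT mk gx κ Φ t p D) f).natAbs ≤ 10 * nL κ Φ t p D (gT mk gx κ Φ t p D) f) :
    (Neg.K κ : ℤ) * ((Neg.Kq κ : ℤ) * (6 * (RA' κ Φ t p D mk : ℤ) + 11)) ≤ ((fcellsA κ Φ t p D (gT mk gx κ Φ t p D) f).r 0 : ℤ) ∧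
      (Neg.K κ : ℤ) * ((Neg.Kq κ : ℤ) * (14 * (RA' κ Φ t p D mk : ℤ) + 27)) ≤ ((fcellsA κ Φ t p D (gT mk gx κ Φ t p D) f).r 1 : ℤ) := by
  obtain ⟨h0, h1⟩ := cells_geTA κ Φ t p D mk gx f hN hκ
  have hK : (0 : ℤ) ≤ Neg.K κ := Nat.cast_nonneg _
  rw [(fcellsA κ Φ t p D (gT mk gx κ Φ t p D) f).r_eq 0, (fcellsA κ Φ t p D (gT mk gx κ Φ t p D) f).r_eq 1, (fcellsA_K κ Φ t p D (gT mk gx κ Φ t p D) f).1]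
  exact ⟨mul_le_mul_of_nonneg_left h0 hK, mul_le_mul_of_nonneg_left h1 hK⟩

end AtValues

end KS

end NegB

end PlanarSkeletonFrm

end Summit.CriticalPhenomena.PercolationContinuityZ3.Theorems.Transplant

end
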